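import Summits.HodgeConjecture.HodgeConjecture.Theorems.Ring2DeformCompactPencils
import HarnessLib

/-!
# Ring 2 · route `deform`, VI — CM-POINTED and 6.3.1-ANCHORED compact pencils: the CM-localised
# transport inputs TYPED, and why none of them is complementary to `HC_CM` (kernel, modulo one junction)

HONEST FRAMING: research route conditional on HC_CM; not a corollary; Q11.4-sentence-2 already refuted in dim ≥ 3.

Cell `pub-hodge-ring2`, seat `pub-hodge-ring2-deform` (gen 7, last part of the axis). `HC_CM` =
`Theses.RankFourFaces.CMAbelianHodge` is an explicit BINDER `hCM` wherever it is used and is never cited as a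
fact; `HC_AV` = `Theses.PadicSemiregularLift.HodgeAbelianVarieties`. No statement minted in this cell is cited
as a fact: the two OPEN nodes below are `@[conjecture]` defs used only as hypotheses, André's Lemme 6.3.1 enters as
the literature seat's named fact `andre1996_cmAnchoredPencil` (a THEOREM in print, binder `h₂₁`), and the one
print chain this file needs beyond it — Lemmes 6.3.2–6.3.3 WITH clause (i) "X_{s_j} isogène à B_j" (B_j of CM
type) retained — is the displayed INLINE binder `J₂₂⁺` (local notation for a displayed `Prop`, §D), never a
fact.

## What this part does, and why it is typed at all

Part IV (honest column (3)) declined to type a "CM-anchored" weakening of `CompactAbelianPencilVHC` (transport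
of algebraicity only along compact pencils having a CM fibre) on the ground that in PRINT it re-derives `HC_CM`
(the pencils of Lemme 6.3.3 have CM fibres), i.e. it is KIND 1 like every blanket transport input (RING2-MAP
D.13). This last part types the two natural CM-localised inputs ONLY to turn that prose verdict into kernel
theorems with the missing print clause displayed, and to record a typing collapse; nothing here is sold as a
narrowing of the conjectural input, and nothing is a new case of the Hodge conjecture.

* §A NODES. `CMPointedCompactPencilVHC` (CPVHC_CM): `Abdulali1994.InvariantCyclesHoldFor f d` for every
  compact pencil of abelian varieties `f` (André's «pinceau compact», `Motives.IsCompactAbelianPencil f d`)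
  possessing a fibre `𝒳_t ≅ A₀.X` with `A₀` of CM type (`Milne1999.IsOfCMType`, the binder of `HC_CM`).
  `CMAnchoredPencilVHC` (R_{6.3.1}): transport asked ONLY along the pencils of Lemme 6.3.1 — for every abelian
  variety `A`, every `p`, every class `c` and every `f` with `Andre1996.IsCMAnchoredPencilFor A p c f` (the
  literature seat's predicate: relative dimension `2·dim A`, a CM fibre, a fibre receiving a homomorphism from
  `A` pulling a global `(p,p)` section back to `q·c`), `InvariantCyclesHoldFor f (2·dim A)`. This is, symbol
  for symbol, the LEAST the proof of row V′ (part IV `HC_AV_of_andre1996_of_HC_CM_of_compactAbelianPencilVHC`)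
  uses of its transport hypothesis.
* §B ORDER (unconditional): `AbelianSchemeVHC ⟹ CompactAbelianPencilVHC ⟹ CPVHC_CM ⟹ R_{6.3.1}`, all
  implied by `HC_AV` and by `HodgeConjecture` (on path).
* §C ROWS (kernel, `HC_CM` LOAD-BEARING, granted Lemme 6.3.1 = `h₂₁`): `HC_CM ∧ R_{6.3.1} ⟹ HC_AV`
  (`HC_AV_of_andre1996_of_HC_CM_of_cmAnchoredPencilVHC`; `hCM` consumed at the CM fibre of the 6.3.1 pencil),
  hence the same for CPVHC_CM; exactness `HC_AV ↔ HC_CM ∧ R_{6.3.1} ↔ HC_CM ∧ CPVHC_CM`; the item readings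
  `CMToAbelian ↔ (HC_CM → R_{6.3.1}) ↔ (HC_CM → CPVHC_CM)` (stmt-HodgeConjecture-16267, nothing closes it);
  and under `HC_CM` the three pencil nodes coincide.
* §D THE KIND COLUMN, MADE KERNEL. (1) TYPING COLLAPSE (pure kernel, no print):
  `cmAnchoredPencilVHC_iff_cmPointed_twiceDim` — R_{6.3.1} is EQUIVALENT to transport on every CM-pointed
  compact pencil of relative dimension `2·dim A` (`A` any abelian variety): the anchoring clause of
  `IsCMAnchoredPencilFor` is vacuous at `c = 0` (`isCMAnchoredPencilFor_zero`: `W = 0`, `g = 0`, `q = 1`), so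
  "transport only along the 6.3.1 pencil OF THE CLASS" is not a per-class restriction once typed.
  (2) DOMINATION modulo the junction `J₂₂⁺` (= fact #22 `andre1996_cmHodgeClasses_algebraicallyAnchoredPencils`
  with two printed clauses retained that the fact drops: the pencil of Lemme 6.3.3 has a CM fibre — (i) p. 33
  "X_{s_j} isogène à B_j", `B_j` "de type CM par E" (6.3.2, p. 32) — and even relative dimension `dim B_j =
  p[E:ℚ] = 2·p[E⁺:ℚ]`, written `2·dim A'`): `J₂₂⁺ ∧ R_{6.3.1} ⟹ HC_CM` with NO `HC_CM` hypothesis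
  (`HC_CM_of_junction_of_cmAnchoredPencilVHC`), hence `J₂₂⁺ ∧ h₂₁ ⊢ HC_AV ↔ R_{6.3.1} ↔ CPVHC_CM` and
  `(HC_CM ∧ R_{6.3.1}) ↔ R_{6.3.1}`: KIND 1, exactly as `CompactAbelianPencilVHC` (part IV (E₃′), there modulo
  fact #22 itself). `J₂₂⁺ ⟹ fact #22` is proved (`andre1996_fact22_of_junction`), so the junction is a
  REFINEMENT of the cited theorem, not a new claim; it is a binder because the literature seat's predicate
  `IsAlgebraicallyAnchoredPencilFor` does not record clause (i)'s CM type (exact missing typed clause: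
  `∃ t A₀, A₀.X ≅ 𝒳_t ∧ IsOfCMType A₀` for the 6.3.3 pencil).
* §E ON PATH (C6): both nodes and both right-hand sides `HC_CM → node` follow from `HodgeConjecture`.

HONEST COLUMN. (a) KIND: CPVHC_CM and R_{6.3.1} are complementary to `HC_CM` in the kernel granted `h₂₁` alone
(§C: `HC_CM` is a genuine factor), and DOMINATING (KIND 1) granted the print chain `J₂₂⁺` (§D) — the same
two-faced status as `CompactAbelianPencilVHC` (part IV §B/§C) and `AbelianSchemeVHC` (part I rows D/M vs V);
the CM-localisation buys nothing in print. (b) The single-class directional form ("along a 6.3.1 datum,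
algebraicity AT THE CM FIBRE `t` implies algebraicity at `s`") escapes the zero-witness collapse but not the
verdict: in the proof of Lemme 6.3.3 the algebraic anchor is `V₀ ⊗ E` with `V₀` "par exemple le H¹ d'une
puissance p-ième d'une courbe elliptique" (p. 33) — choosing that curve with complex multiplication makes the
anchor a CM fibre where every Hodge class is algebraic unconditionally ([KuM91] §2 as cited there), and the
fibre square of the 6.3.3 pencil with `B_j ↪ X_{s_j} × X_{s_j}` is a 6.3.1-shaped datum; NOT typed (fibre
products of pencils are not in the tree) — prose, RING2-MAP D.23. (c) `J₂₂⁺` has no on-path lemma (it asserts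
the existence of pencils; `HodgeConjecture` does not produce families), like fact #20 in part II. (d) With
this part the deform axis is closed from below: every typed transport input on it — blanket (I), uniform at CM
points (II), printed MT families (III), compact pencils (IV), CM-pointed / 6.3.1-anchored pencils (VI) — is
implied by `HC_AV`, gives `HC_AV` together with `HC_CM`, and is KIND 1 in print; the arithmetic row (V) is the
only one whose domination is itself open (Conjecture B). (e) Semiregularity / Bloch's theorem (Q11.4) is not
used anywhere on this axis. RING2-MAP §deform D.20–D.23.

References (keys of `references.bib`): Andre1996Motifs (Lemmes 6.3.1–6.3.3 and proof of 6.3.3, Remarque 2,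
pp. 31–33; held text doi:10.1007/bf02698643, PDF pp. 28–30), Abdulali1994FamiliesAV ((1.1), Lemma 6.2),
CharlesSchnell2014Notes (Conj. 11.3.1, Cor. 11.3.6), Milne2020HodgeClassesAV (arXiv:2010.08857, EXPOSITORY
NOTES, UNREFEREED — cited for Rem. 2–3 only, nothing of it is used as a fact), Andre1992HodgeCM.
-/

noncomputable section

set_option linter.dupNamespace false

namespace Summit.HodgeConjecture.HodgeConjecture.Ring2.Deform

open CategoryTheory AlgebraicGeometry
open Literature.AlgebraicGeometry Literature.AlgebraicGeometry.Motives
open Literature.AlgebraicGeometry.HodgeTheory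
open Literature.AlgebraicGeometry.Milne1999 (IsOfCMType CMHodgeHypothesisAt)
open Literature.AlgebraicGeometry.Abdulali1994 (InvariantCyclesHoldFor)
open Literature.AlgebraicGeometry.Andre1996 (andre1996_cmAnchoredPencil IsCMAnchoredPencilFor
  IsAlgebraicallyAnchoredPencilFor andre1996_cmHodgeClasses_algebraicallyAnchoredPencils)
open Summit.HodgeConjecture.HodgeConjecture
open Summit.HodgeConjecture.HodgeConjecture.Theses
open Summit.HodgeConjecture.HodgeConjecture.Ring2.Hypotheses (AbelianSchemeVHC)
open Summit.HodgeConjecture.HodgeConjecture.Theorems.HodgeAbelianVarieties.Negative (iff_hodgeConjecture_restricted)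

/-! ## §A The two CM-localised nodes -/

/-- **TRANSPORT OF ALGEBRAICITY ON CM-POINTED COMPACT PENCILS OF ABELIAN VARIETIES** (CPVHC_CM). For every
compact pencil of abelian varieties `f : 𝒳 ⟶ S` of relative dimension `d` (`Motives.IsCompactAbelianPencil`)
having a fibre `𝒳_t ≅ A₀.X` with `A₀` of CM type, `Abdulali1994.InvariantCyclesHoldFor f d` (a global class of
type `(p,p)` on every fibre, algebraic on one fibre, is algebraic on every fibre). OPEN; implied by
`CompactAbelianPencilVHC` and by `HC_AV` (§B). A HYPOTHESIS wherever used. KIND: see §C/§D and the header.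
[cite: Andre1996Motifs, §6.3 footnote (2) (p. 31) and Remarque 2 (p. 33)] [cite: Abdulali1994FamiliesAV, (1.1)] -/
@[conjecture] def CMPointedCompactPencilVHC : Prop :=
  ∀ ⦃d : ℕ⦄ ⦃𝒳 S : SchemeOver ℂ⦄ (f : 𝒳 ⟶ S), IsCompactAbelianPencil f d →
    (∃ (t : ComplexPoints S) (A₀ : AbelianVariety ℂ), Nonempty (A₀.X ≅ fiberOver f t) ∧ IsOfCMType A₀) →
      InvariantCyclesHoldFor f d

/-- **TRANSPORT OF ALGEBRAICITY ALONG THE PENCILS OF LEMME 6.3.1** (R_{6.3.1}). For every complex abelian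
variety `A`, every `p`, every class `c ∈ H^{2p}(A(ℂ); ℂ)` and every `f : 𝒳 ⟶ S` with
`Andre1996.IsCMAnchoredPencilFor A p c f` (a compact pencil of relative dimension `2·dim A` with a CM fibre and a
fibre receiving a homomorphism from `A` that pulls a global `(p,p)` section back to `q·c`, `q ≠ 0`),
`InvariantCyclesHoldFor f (2·dim A)`. Exactly what row V′ uses of its transport hypothesis. OPEN; implied by
CPVHC_CM (§B); EQUIVALENT to transport on all CM-pointed compact pencils of relative dimension `2·dim A` (§D (1)).
[cite: Andre1996Motifs, Lemme 6.3.1 (p. 31)] [cite: Abdulali1994FamiliesAV, Lemma 6.2 (p. 1131)] -/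
@[conjecture] def CMAnchoredPencilVHC : Prop :=
  ∀ (A : AbelianVariety ℂ) (p : ℕ) (c : complexBetti A.X (2 * p)) ⦃𝒳 S : SchemeOver ℂ⦄ (f : 𝒳 ⟶ S),
    IsCMAnchoredPencilFor A p c f → InvariantCyclesHoldFor f (2 * A.dim)

/-! ## §B The order of the pencil inputs (unconditional) and the on-path lemmas -/

/-- `CompactAbelianPencilVHC ⟹ CPVHC_CM` (drop the CM-point hypothesis). [folklore] -/
theorem cmPointedCompactPencilVHC_of_compactAbelianPencilVHC (hV : CompactAbelianPencilVHC) :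
    CMPointedCompactPencilVHC :=
  fun _ _ _ f hf _ ↦ hV f hf

/-- `CPVHC_CM ⟹ R_{6.3.1}`: a 6.3.1 pencil is a CM-pointed compact pencil.
[cite: Andre1996Motifs, Lemme 6.3.1 (ii) (p. 31)] -/
theorem cmAnchoredPencilVHC_of_cmPointedCompactPencilVHC (hV : CMPointedCompactPencilVHC) :
    CMAnchoredPencilVHC := by
  intro A p c 𝒳 S f hanch
  obtain ⟨hf, _s, t, _W, _A₁, A₀, _e₁, _g, _q, _hW, _hq, _hgc, he₀, hA₀⟩ := hanch
  exact hV f hf ⟨t, A₀, he₀, hA₀⟩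

/-- `AbelianSchemeVHC ⟹ CPVHC_CM` (through part IV `compactAbelianPencilVHC_of_abelianSchemeVHC`). [folklore] -/
theorem cmPointedCompactPencilVHC_of_abelianSchemeVHC (hV : AbelianSchemeVHC) : CMPointedCompactPencilVHC :=
  cmPointedCompactPencilVHC_of_compactAbelianPencilVHC (compactAbelianPencilVHC_of_abelianSchemeVHC hV)

/-- ON-PATH: `HC_AV ⟹ CPVHC_CM` (Charles–Schnell Cor. 11.3.6 on compact pencils, part IV).
[cite: CharlesSchnell2014Notes, Cor. 11.3.6 (p. 494)] -/
theorem cmPointedCompactPencilVHC_of_HC_AV (h : PadicSemiregularLift.HodgeAbelianVarieties) :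
    CMPointedCompactPencilVHC :=
  cmPointedCompactPencilVHC_of_compactAbelianPencilVHC (compactAbelianPencilVHC_of_HC_AV h)

/-- ON-PATH: `HC_AV ⟹ R_{6.3.1}`. [cite: CharlesSchnell2014Notes, Cor. 11.3.6 (p. 494)] -/
theorem cmAnchoredPencilVHC_of_HC_AV (h : PadicSemiregularLift.HodgeAbelianVarieties) : CMAnchoredPencilVHC :=
  cmAnchoredPencilVHC_of_cmPointedCompactPencilVHC (cmPointedCompactPencilVHC_of_HC_AV h)

/-- ON-PATH (C6): `HodgeConjecture ⟹ CPVHC_CM`. [folklore] -/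
theorem cmPointedCompactPencilVHC_of_hodgeConjecture (h : _root_.HodgeConjecture) : CMPointedCompactPencilVHC :=
  cmPointedCompactPencilVHC_of_HC_AV (HC_AV_of_hodgeConjecture h)

/-- ON-PATH (C6): `HodgeConjecture ⟹ R_{6.3.1}`. [folklore] -/
theorem cmAnchoredPencilVHC_of_hodgeConjecture (h : _root_.HodgeConjecture) : CMAnchoredPencilVHC :=
  cmAnchoredPencilVHC_of_HC_AV (HC_AV_of_hodgeConjecture h)

/-! ## §C Rows with `HC_CM` load-bearing (granted Lemme 6.3.1 only) -/

/-- **Lemme 6.3.1 + R_{6.3.1} + Hodge for CM abelian varieties ⟹ Hodge for every complex abelian variety**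
(literature-level form; the proof of `Andre1996.hodgeConjecture_abelian_of_cmAnchoredPencil` verbatim, with the
transport hypothesis applied only to the 6.3.1 pencil of the class: at the CM fibre `𝒳_t ≅ A₀.X` the section is
algebraic by the CM hypothesis, transport carries it to `𝒳_s`, `e₁` and `g` bring it back to `q·c`, `q ≠ 0`).
[cite: Andre1996Motifs, Lemme 6.3.1 (p. 31) and §6.3 a) (p. 33)] [cite: Abdulali1994FamiliesAV, Lemma 6.2 (p. 1131)] -/
theorem hodgeConjecture_abelian_of_cm_of_cmAnchoredPencilVHC (h₂₁ : andre1996_cmAnchoredPencil)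
    (hR : CMAnchoredPencilVHC) (hCM : ∀ A : AbelianVariety ℂ, CMHodgeHypothesisAt A) :
    ∀ A : AbelianVariety ℂ, IsSmoothProjective A.dim A.X → HodgeConjectureFor A.dim A.X := by
  intro A hA
  refine (hodgeConjectureFor_iff_of_isSmoothProjective nonempty_hodgeModel_holds hA).2 ?_
  intro p c hc hpp
  obtain ⟨𝒳, S, f, hanch⟩ := h₂₁ A hA p c hc hpp
  have hV : InvariantCyclesHoldFor f (2 * A.dim) := hR A p c f hanch
  obtain ⟨hf, s, t, W, A₁, A₀, e₁, g, q, hW, hq, hgc, ⟨e₀⟩, hA₀⟩ := hanch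
  -- the CM fibre `𝒳_t ≅ A₀.X`: `dim A₀ = 2 dim A`, and the CM hypothesis makes `W|_{𝒳_t}` algebraic
  have hA₀sp : IsSmoothProjective A₀.dim A₀.X := AbelianVariety.isSmoothProjective_holds
  have hdim : A₀.dim = 2 * A.dim := Andre1996.compactPencil_dim_eq_of_iso hf e₀
  have h₀ : complexBetti.map (fiberι f t) (2 * p) W ∈ algebraicClasses (fiberOver f t) p := by
    have hHC := (hCM A₀ hA₀sp hA₀).2 p
    rw [hdim] at hHC
    exact (forall_hodgeClass_mem_algebraicClasses_iff_of_iso e₀ p).1 hHC _ (hW t).1 (hW t).2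
  -- transport along THIS pencil from `t` to `s`, then across `e₁` and back along `g`
  have h₁ := hV p W hW ⟨t, h₀⟩ s
  have h₂ : complexBetti.map e₁.hom (2 * p) (complexBetti.map (fiberι f s) (2 * p) W) ∈
      algebraicClasses A₁.X p :=
    (mem_algebraicClasses_map_iff_of_iso e₁).2 h₁
  have h₃ : (q : ℂ) • c ∈ algebraicClasses A.X p := by
    rw [← hgc]
    exact map_mem_algebraicClasses_of_abelianVariety hA A₁ g.hom.hom.hom h₂
  exact (Submodule.smul_mem_iff _ (Rat.cast_ne_zero.2 hq)).1 h₃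

/-- **ROW V″: `HC_CM ∧ R_{6.3.1} ⟹ HC_AV`, granted Lemme 6.3.1** (`hCM` consumed, by name, at the CM fibres;
guards `Ring2Transport.HC_CM_iff_forall_cmHodgeHypothesisAt`, `iff_hodgeConjecture_restricted`). The transport
input of part IV row V′ cut down to what its proof uses. [cite: Andre1996Motifs, Lemme 6.3.1 (p. 31)]
[cite: Abdulali1994FamiliesAV, Lemma 6.2 (p. 1131)] -/
theorem HC_AV_of_andre1996_of_HC_CM_of_cmAnchoredPencilVHC (h₂₁ : andre1996_cmAnchoredPencil)
    (hCM : RankFourFaces.CMAbelianHodge) (hR : CMAnchoredPencilVHC) :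
    PadicSemiregularLift.HodgeAbelianVarieties :=
  iff_hodgeConjecture_restricted.2 (hodgeConjecture_abelian_of_cm_of_cmAnchoredPencilVHC h₂₁ hR
    (Ring2Transport.HC_CM_iff_forall_cmHodgeHypothesisAt.1 hCM))

/-- **ROW V″ (CM-pointed form): `HC_CM ∧ CPVHC_CM ⟹ HC_AV`, granted Lemme 6.3.1.**
[cite: Andre1996Motifs, Lemme 6.3.1 (p. 31)] [cite: Abdulali1994FamiliesAV, Lemma 6.2 (p. 1131)] -/
theorem HC_AV_of_andre1996_of_HC_CM_of_cmPointedCompactPencilVHC (h₂₁ : andre1996_cmAnchoredPencil)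
    (hCM : RankFourFaces.CMAbelianHodge) (hV : CMPointedCompactPencilVHC) :
    PadicSemiregularLift.HodgeAbelianVarieties :=
  HC_AV_of_andre1996_of_HC_CM_of_cmAnchoredPencilVHC h₂₁ hCM (cmAnchoredPencilVHC_of_cmPointedCompactPencilVHC hV)

/-- **EXACTNESS**: granted Lemme 6.3.1, `HC_AV ↔ HC_CM ∧ R_{6.3.1}` (`HC_CM` a genuine factor here; §D: not in
print).
[cite: Andre1996Motifs, Lemme 6.3.1 and Remarque 2 (pp. 31–33)] [cite: CharlesSchnell2014Notes, Cor. 11.3.6] -/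
theorem HC_AV_iff_HC_CM_and_cmAnchoredPencilVHC_of_andre1996 (h₂₁ : andre1996_cmAnchoredPencil) :
    PadicSemiregularLift.HodgeAbelianVarieties ↔ (RankFourFaces.CMAbelianHodge ∧ CMAnchoredPencilVHC) :=
  ⟨fun h ↦ ⟨HC_CM_of_HC_AV h, cmAnchoredPencilVHC_of_HC_AV h⟩,
    fun h ↦ HC_AV_of_andre1996_of_HC_CM_of_cmAnchoredPencilVHC h₂₁ h.1 h.2⟩

/-- **EXACTNESS (CM-pointed form)**: granted Lemme 6.3.1, `HC_AV ↔ HC_CM ∧ CPVHC_CM`.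
[cite: Andre1996Motifs, Lemme 6.3.1 and Remarque 2 (pp. 31–33)] [cite: CharlesSchnell2014Notes, Cor. 11.3.6] -/
theorem HC_AV_iff_HC_CM_and_cmPointedCompactPencilVHC_of_andre1996 (h₂₁ : andre1996_cmAnchoredPencil) :
    PadicSemiregularLift.HodgeAbelianVarieties ↔ (RankFourFaces.CMAbelianHodge ∧ CMPointedCompactPencilVHC) :=
  ⟨fun h ↦ ⟨HC_CM_of_HC_AV h, cmPointedCompactPencilVHC_of_HC_AV h⟩,
    fun h ↦ HC_AV_of_andre1996_of_HC_CM_of_cmPointedCompactPencilVHC h₂₁ h.1 h.2⟩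

/-- **`CMToAbelian ↔ (HC_CM → R_{6.3.1})`**: granted Lemme 6.3.1, the tree's OPEN reduction item
stmt-HodgeConjecture-16267 is EQUIVALENT to "under `HC_CM`, transport of algebraicity along André's 6.3.1
pencils" — the sharpest item reading on the deform axis (compare part III §C, part IV §C). Nothing closes it.
[cite: Andre1996Motifs, Lemme 6.3.1 (p. 31)] [cite: CharlesSchnell2014Notes, Conj. 11.3.1 and Cor. 11.3.6] -/
theorem cmToAbelian_iff_HC_CM_imp_cmAnchoredPencilVHC (h₂₁ : andre1996_cmAnchoredPencil) :
    RankFourFaces.CMToAbelian ↔ (RankFourFaces.CMAbelianHodge → CMAnchoredPencilVHC) := by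
  constructor
  · intro h hCM
    exact cmAnchoredPencilVHC_of_HC_AV (Hypotheses.hc_av_iff_hc_cm_and_cmToAbelian.2 ⟨hCM, h⟩)
  · intro h hCM A _
    exact HC_AV_of_andre1996_of_HC_CM_of_cmAnchoredPencilVHC h₂₁ hCM (h hCM) A

/-- **`CMToAbelian ↔ (HC_CM → CPVHC_CM)`**, granted Lemme 6.3.1. [cite: Andre1996Motifs, Lemme 6.3.1 (p. 31)] -/
theorem cmToAbelian_iff_HC_CM_imp_cmPointedCompactPencilVHC (h₂₁ : andre1996_cmAnchoredPencil) :
    RankFourFaces.CMToAbelian ↔ (RankFourFaces.CMAbelianHodge → CMPointedCompactPencilVHC) := by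
  constructor
  · intro h hCM
    exact cmPointedCompactPencilVHC_of_HC_AV (Hypotheses.hc_av_iff_hc_cm_and_cmToAbelian.2 ⟨hCM, h⟩)
  · intro h hCM A _
    exact HC_AV_of_andre1996_of_HC_CM_of_cmPointedCompactPencilVHC h₂₁ hCM (h hCM) A

/-- **Under `HC_CM` the three pencil nodes coincide** (granted Lemme 6.3.1; all pass through `HC_AV`).
[cite: Andre1996Motifs, Lemme 6.3.1 and Remarque 2 (pp. 31–33)] -/
theorem pencilNodes_iff_of_andre1996_of_HC_CM (h₂₁ : andre1996_cmAnchoredPencil)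
    (hCM : RankFourFaces.CMAbelianHodge) :
    (CMAnchoredPencilVHC ↔ CMPointedCompactPencilVHC) ∧ (CMPointedCompactPencilVHC ↔ CompactAbelianPencilVHC) :=
  ⟨⟨fun hR ↦ cmPointedCompactPencilVHC_of_HC_AV
        (HC_AV_of_andre1996_of_HC_CM_of_cmAnchoredPencilVHC h₂₁ hCM hR),
      cmAnchoredPencilVHC_of_cmPointedCompactPencilVHC⟩,
    ⟨fun hV ↦ compactAbelianPencilVHC_of_HC_AV
        (HC_AV_of_andre1996_of_HC_CM_of_cmPointedCompactPencilVHC h₂₁ hCM hV),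
      cmPointedCompactPencilVHC_of_compactAbelianPencilVHC⟩⟩

/-- ON-PATH for §C: the right-hand side `HC_CM → R_{6.3.1}` follows from the Hodge conjecture. [folklore] -/
theorem HC_CM_imp_cmAnchoredPencilVHC_of_hodgeConjecture (h : _root_.HodgeConjecture) :
    RankFourFaces.CMAbelianHodge → CMAnchoredPencilVHC :=
  fun _ ↦ cmAnchoredPencilVHC_of_hodgeConjecture h

/-! ## §D The KIND column in the kernel: typing collapse, and domination modulo the junction `J₂₂⁺` -/

/-- **Zero witness**: every CM-pointed compact pencil of relative dimension `2·dim A` is "6.3.1-anchored" for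
`(A, p, 0)` — take `W = 0` (rational of type `(p,p)` on every fibre: `IsRationalClass.zero`,
`isOfHodgeType_zero_of_isSmoothProjective` on the smooth projective fibres), the CM fibre itself as the anchor
fibre, `g = 0` (`AbelianVariety.instPreadditive`) and `q = 1`. Pure typing; no print. [folklore] -/
theorem isCMAnchoredPencilFor_zero (A : AbelianVariety ℂ) (p : ℕ) {𝒳 S : SchemeOver ℂ} {f : 𝒳 ⟶ S}
    (hf : IsCompactAbelianPencil f (2 * A.dim))
    (ht : ∃ (t : ComplexPoints S) (A₀ : AbelianVariety ℂ),
      Nonempty (A₀.X ≅ fiberOver f t) ∧ IsOfCMType A₀) :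
    IsCMAnchoredPencilFor A p 0 f := by
  obtain ⟨t, A₀, ⟨e₀⟩, hA₀⟩ := ht
  refine ⟨hf, t, t, 0, A₀, A₀, e₀, 0, 1, fun s' ↦ ?_, one_ne_zero, ?_, ⟨e₀⟩, hA₀⟩
  · rw [map_zero]
    exact ⟨IsRationalClass.zero, isOfHodgeType_zero_of_isSmoothProjective nonempty_hodgeModel_holds
      (hf.isSmoothProjectiveFamily.isSmoothProjective s') _ _ _⟩
  · simp only [map_zero, Rat.cast_one, one_smul]

/-- **TYPING COLLAPSE**: R_{6.3.1} is EQUIVALENT to transport of algebraicity on every CM-pointed compact pencil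
of relative dimension `2·dim A`, `A` ranging over all complex abelian varieties — the per-class anchoring is no
restriction (zero witness). Pure kernel. [folklore] -/
theorem cmAnchoredPencilVHC_iff_cmPointed_twiceDim :
    CMAnchoredPencilVHC ↔
      ∀ (A : AbelianVariety ℂ) ⦃𝒳 S : SchemeOver ℂ⦄ (f : 𝒳 ⟶ S),
        IsCompactAbelianPencil f (2 * A.dim) →
        (∃ (t : ComplexPoints S) (A₀ : AbelianVariety ℂ),
          Nonempty (A₀.X ≅ fiberOver f t) ∧ IsOfCMType A₀) →
          InvariantCyclesHoldFor f (2 * A.dim) := by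
  refine ⟨fun h A 𝒳 S f hf ht ↦ h A 0 0 f (isCMAnchoredPencilFor_zero A 0 hf ht),
    fun h A p c 𝒳 S f hanch ↦ ?_⟩
  obtain ⟨hf, _s, t, _W, _A₁, A₀, _e₁, _g, _q, _hW, _hq, _hgc, he₀, hA₀⟩ := hanch
  exact h A f hf ⟨t, A₀, he₀, hA₀⟩

/- The junction `J₂₂⁺` (a displayed `Prop`, entered ONLY as a binder; plain comment, a notation carries no
docstring): André 1996, Lemmes 6.3.2–6.3.3 in the rendering of the literature seat's fact
`andre1996_cmHodgeClasses_algebraicallyAnchoredPencils`, with two printed clauses RETAINED that the fact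
drops — the 6.3.3 pencil carrying `w` has a CM fibre ((i) p. 33: "X_{s_j} isogène à B_j", `B_j` of CM type by
6.3.2) and relative dimension `2·dim A'` for some abelian variety `A'` (`dim B_j = p[E:ℚ]`, `E` a CM field).
Print gives the fibre `X_{s_j}` only ISOGENOUS to the CM variety `B_j`; the clause below records it as
`∃ t A₀, A₀.X ≅ 𝒳_t ∧ IsOfCMType A₀` because the fibre is itself (the variety of) an abelian variety
(`Andre1996.compactPencil_exists_abelianVariety_fiber_dim`) and being of CM type is isogeny-invariant
(`End⁰` is; tree `Milne1999.isOfCMType_iff_of_isIsogenous`), hence the fibre is itself of CM type (ref1 F25).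
A THEOREM in print; not formalised; not a Literature fact. -/
set_option quotPrecheck false in
local notation "J₂₂⁺" =>
  (∀ (B : AbelianVariety ℂ), IsSmoothProjective B.dim B.X → IsOfCMType B →
    ∀ (p : ℕ), 1 < p → ∀ (c : complexBetti B.X (2 * p)), IsRationalClass c →
      IsOfHodgeType B.dim B.X (2 * p) p p c →
        c ∈ Submodule.span ℂ
          {c' : complexBetti B.X (2 * p) |
            ∃ (B' : AbelianVariety ℂ) (g : B ⟶ B') (w : complexBetti B'.X (2 * p)) (A' : AbelianVariety ℂ)
              (𝒳 S : SchemeOver ℂ) (f : 𝒳 ⟶ S),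
              IsAlgebraicallyAnchoredPencilFor B' p w f (2 * A'.dim) ∧
                (∃ (t : ComplexPoints S) (A₀ : AbelianVariety ℂ),
                  Nonempty (A₀.X ≅ fiberOver f t) ∧ IsOfCMType A₀) ∧
                c' = complexBetti.map g.hom.hom.hom (2 * p) w})

/-- **The junction refines the cited theorem**: `J₂₂⁺ ⟹` fact #22 (forget the two retained clauses).
[cite: Andre1996Motifs, Lemmes 6.3.2–6.3.3 (pp. 32–33)] -/
theorem andre1996_fact22_of_junction (h : J₂₂⁺) : andre1996_cmHodgeClasses_algebraicallyAnchoredPencils := by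
  intro B hB hCM p hp c hc hpp
  refine Submodule.span_mono ?_ (h B hB hCM p hp c hc hpp)
  rintro c' ⟨B', g, w, A', 𝒳, S, f, hpencil, -, hc'⟩
  exact ⟨B', g, w, 2 * A'.dim, 𝒳, S, f, hpencil, hc'⟩

/-- **DOMINATION (KIND 1), kernel modulo `J₂₂⁺`: R_{6.3.1} PROVES `HC_CM` with no `HC_CM` hypothesis.** Every
Hodge class on a CM abelian variety lies in the span of pull-backs of classes carried by algebraically anchored,
CM-pointed compact pencils of relative dimension `2·dim A'` (`J₂₂⁺`); R_{6.3.1} transports along each of them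
(typing collapse) and `IsAlgebraicallyAnchoredPencilFor.mem_algebraicClasses` concludes; codimension `0` and `1`
as in the literature seat's `cmHodgeHypothesisAt_of_algebraicallyAnchoredPencils`. The CM-localisation of the
transport input buys NOTHING in print. [cite: Andre1996Motifs, Lemmes 6.3.2–6.3.3 and Remarque 2 (pp. 32–33)]
[cite: Milne2020HodgeClassesAV, Rem. 2–3] -/
theorem HC_CM_of_junction_of_cmAnchoredPencilVHC (h₂₂ : J₂₂⁺) (hR : CMAnchoredPencilVHC) :
    RankFourFaces.CMAbelianHodge := by
  refine Ring2Transport.HC_CM_iff_forall_cmHodgeHypothesisAt.2 fun B hB hCM ↦ ?_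
  refine (hodgeConjectureFor_iff_of_isSmoothProjective nonempty_hodgeModel_holds hB).2 ?_
  intro p c hc hpp
  obtain _ | _ | p := p
  · exact hodgeConjectureFor_codim_zero c
  · exact lefschetzOneOne_rational_holds hB c hc hpp
  · refine (Submodule.span_le.mpr ?_) (h₂₂ B hB hCM (p + 2) (by omega) c hc hpp)
    rintro _ ⟨B', g, w, A', 𝒳, S, f, hpencil, ht, rfl⟩
    exact map_mem_algebraicClasses_of_abelianVariety hB B' g.hom.hom.hom
      (hpencil.mem_algebraicClasses (cmAnchoredPencilVHC_iff_cmPointed_twiceDim.1 hR A' f hpencil.1 ht))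

/-- **DOMINATION, CM-pointed form**: `J₂₂⁺ ∧ CPVHC_CM ⟹ HC_CM`.
[cite: Andre1996Motifs, Lemmes 6.3.2–6.3.3 (pp. 32–33)] -/
theorem HC_CM_of_junction_of_cmPointedCompactPencilVHC (h₂₂ : J₂₂⁺) (hV : CMPointedCompactPencilVHC) :
    RankFourFaces.CMAbelianHodge :=
  HC_CM_of_junction_of_cmAnchoredPencilVHC h₂₂ (cmAnchoredPencilVHC_of_cmPointedCompactPencilVHC hV)

/-- **`HC_AV` from R_{6.3.1} ALONE, granted Lemme 6.3.1 and `J₂₂⁺`** (`HC_CM` an intermediate conclusion, as in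
part IV (M′)). [cite: Andre1996Motifs, §6.3 (pp. 31–33)] [cite: Milne2020HodgeClassesAV, Rem. 2–3] -/
theorem HC_AV_of_andre1996_of_junction_of_cmAnchoredPencilVHC (h₂₁ : andre1996_cmAnchoredPencil)
    (h₂₂ : J₂₂⁺) (hR : CMAnchoredPencilVHC) : PadicSemiregularLift.HodgeAbelianVarieties :=
  HC_AV_of_andre1996_of_HC_CM_of_cmAnchoredPencilVHC h₂₁ (HC_CM_of_junction_of_cmAnchoredPencilVHC h₂₂ hR) hR

/-- **EXACTNESS WITHOUT `HC_CM`**: granted Lemme 6.3.1 and `J₂₂⁺`, `HC_AV ↔ R_{6.3.1}` and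
`HC_AV ↔ CPVHC_CM` — the CM-localised nodes are `HC_AV` in disguise, exactly as `CompactAbelianPencilVHC`
(part IV (E₂′)).
[cite: Andre1996Motifs, §6.3 Remarque 2 (p. 33)] [cite: CharlesSchnell2014Notes, Cor. 11.3.6] -/
theorem HC_AV_iff_cmLocalisedNodes_of_andre1996_of_junction (h₂₁ : andre1996_cmAnchoredPencil)
    (h₂₂ : J₂₂⁺) :
    (PadicSemiregularLift.HodgeAbelianVarieties ↔ CMAnchoredPencilVHC) ∧
      (PadicSemiregularLift.HodgeAbelianVarieties ↔ CMPointedCompactPencilVHC) :=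
  ⟨⟨cmAnchoredPencilVHC_of_HC_AV, HC_AV_of_andre1996_of_junction_of_cmAnchoredPencilVHC h₂₁ h₂₂⟩,
    ⟨cmPointedCompactPencilVHC_of_HC_AV, fun hV ↦
      HC_AV_of_andre1996_of_junction_of_cmAnchoredPencilVHC h₂₁ h₂₂
        (cmAnchoredPencilVHC_of_cmPointedCompactPencilVHC hV)⟩⟩

/-- **What `HC_CM` is worth next to R_{6.3.1}: nothing**, granted `J₂₂⁺`: `(HC_CM ∧ R_{6.3.1}) ↔ R_{6.3.1}`
(part IV (E₃′) for the CM-localised input). [cite: Andre1996Motifs, §6.3 Remarque 2 (p. 33)] -/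
theorem HC_CM_and_cmAnchoredPencilVHC_iff_of_junction (h₂₂ : J₂₂⁺) :
    (RankFourFaces.CMAbelianHodge ∧ CMAnchoredPencilVHC) ↔ CMAnchoredPencilVHC :=
  ⟨And.right, fun hR ↦ ⟨HC_CM_of_junction_of_cmAnchoredPencilVHC h₂₂ hR, hR⟩⟩

/-- **The item from the node alone**: granted Lemme 6.3.1, `R_{6.3.1} ⟹ CMToAbelian` (a typed conditional TOWARD
the open item 16267; nothing closes it). [cite: Andre1996Motifs, Lemme 6.3.1 (p. 31)] -/
theorem cmToAbelian_of_andre1996_of_cmAnchoredPencilVHC (h₂₁ : andre1996_cmAnchoredPencil)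
    (hR : CMAnchoredPencilVHC) : RankFourFaces.CMToAbelian :=
  (cmToAbelian_iff_HC_CM_imp_cmAnchoredPencilVHC h₂₁).2 fun _ ↦ hR

end Summit.HodgeConjecture.HodgeConjecture.Ring2.Deform

end
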